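import Literature.Computability.QuantumComplexity.AaronsonAmbainisProofs
import HarnessLib

/-!
# Aaronson–Ambainis 2014, Thm. 21 for an abstract bounded polynomial, with explicit `poly(d, 1/ε, 1/δ)`

`AaronsonAmbainisProofs.lean` proves Thm. 7 (i) (`AaronsonAmbainis2014_thm7_holds`) by running the
classical simulation `ClassicalSimulation.simTree` on the acceptance polynomial of a `T`-query
algorithm (degree `d = 2T`). The proof of Aaronson–Ambainis' **Thm. 23** (= Thm. 7 (iii), p. 14;
tree fact `aaronsonAmbainis2014_thm23_apx`) runs the SAME algorithm on the acceptance polynomial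
`p_x` of an oracle machine, a polynomial "in the bits of `B`, of degree at most `poly(n)`"
(`OraclePolynomialMethod.exists_acceptPolynomialOn`) that does not come from a `QQueryAlg`. This
file therefore repackages the `T ≥ 1` branch of that proof for an ABSTRACT real polynomial `p`
of total degree `≤ d` (`d ≥ 1`) with `0 ≤ p ≤ 1` on `{0,1}^N`:

* `ClassicalSimulation.simTree_depth_error_le` (explicit: for constants `c, C₀` satisfying the
  body of `AAConjecture`, the tree `simTree (ε²δ/2) (C₀ ((ε²δ/2)/d)^c) ⌈8d/(wδ)⌉ p` has depth
  `≤ (⌈16·4^c/C₀⌉ + 1)(d/(εδ) + 1)^{4c+2}` and is `ε`-accurate on all but `≤ δ · 2^N` inputs) and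
  its packaging `ClassicalSimulation.exists_simTree_of_AAConjecture` (`∃ C k` under `AAConjecture`) ("`C` halts after at most `SumInf[p₀]/q(εδ/T)` iterations";
  "`Pr[|p_j(X) - E[p_j]| > ε] < δ`", with the `L²` potential `Σ_i Inf_i ≤ 4d` of
  `InfluenceBounds.sum_influence_le`).

The proof is the one of `AaronsonAmbainis2014_thm7_holds` with `u := d/(εδ) + 1` in place of
`T/(εδ) + 1` (all its lemmas — `sum_cost_simTree_mul_le`, `haltError_simTree_le`,
`RealDecisionTree.markov_cost`, `queryBudget_arith` — are already stated for an abstract degree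
bound `d`).

## References

* S. Aaronson, A. Ambainis, *The need for structure in quantum speedups*, Theory Comput. 10
  (2014), Thm. 21 and its proof (arXiv:0911.0996v3, pp. 13–14; ToC Thm. 3.3), and proof of
  Thm. 23 (p. 14: "This `C` is essentially just the algorithm from Theorem 21")
  [AaronsonAmbainis2014].
-/

noncomputable section

namespace Literature.Computability.QuantumComplexity

open Finset

namespace ClassicalSimulation

/-- **Aaronson–Ambainis 2014, Thm. 21, for a bounded polynomial of degree `≤ d` — explicit form.**
Let `c, C₀ > 0` be constants for which the conclusion of Conjecture 6 holds (hypothesis `H`, the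
body of `AAConjecture`). For a real polynomial `p` in `N` variables of total degree `≤ d` (`d ≥ 1`)
with `0 ≤ p ≤ 1` on `{0,1}^N` and `ε, δ ∈ (0, 1]`, the simulation tree
`simTree θ w D p` with `θ = ε²δ/2`, `w = C₀ (θ/d)^c`, `D = ⌈8d/(wδ)⌉` has depth
`≤ (⌈16·4^c/C₀⌉ + 1) · (d/(εδ) + 1)^{4c+2}` and is `ε`-accurate on all but `≤ δ · 2^N` inputs. [cite: AaronsonAmbainis2014, Thm. 21 (proof, pp. 13–14)] -/
theorem simTree_depth_error_le {c : ℕ} {C : ℝ} (hC : 0 < C)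
    (H : ∀ (N d : ℕ) (p : MvPolynomial (Fin N) ℝ) (ε : ℝ), 1 ≤ d → p.totalDegree ≤ d →
      (∀ x, 0 ≤ evalBool p x ∧ evalBool p x ≤ 1) → 0 < ε → ε ≤ boolVariance p →
        ∃ i : Fin N, C * (ε / d) ^ c ≤ influence i p)
    {N d : ℕ} (hd1 : 1 ≤ d) {p : MvPolynomial (Fin N) ℝ} (hdeg : p.totalDegree ≤ d)
    (hbd : ∀ x, 0 ≤ evalBool p x ∧ evalBool p x ≤ 1) {ε δ : ℝ} (hε : 0 < ε) (hε1 : ε ≤ 1)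
    (hδ : 0 < δ) (hδ1 : δ ≤ 1) :
    ((simTree (ε ^ 2 * δ / 2) (C * ((ε ^ 2 * δ / 2) / d) ^ c)
        (Nat.ceil (8 * (d : ℝ) / ((C * ((ε ^ 2 * δ / 2) / d) ^ c) * δ))) p).depth : ℝ) ≤
        (Nat.ceil (16 * 2 ^ c * 2 ^ c / C) + 1 : ℕ) * ((d : ℝ) / (ε * δ) + 1) ^ (4 * c + 2) ∧
      ((univ.filter fun x : Fin N → Bool => ε <
          |(simTree (ε ^ 2 * δ / 2) (C * ((ε ^ 2 * δ / 2) / d) ^ c)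
              (Nat.ceil (8 * (d : ℝ) / ((C * ((ε ^ 2 * δ / 2) / d) ^ c) * δ))) p).eval x -
            evalBool p x|).card : ℝ) ≤ δ * 2 ^ N := by
  set u : ℝ := (d : ℝ) / (ε * δ) + 1 with hu
  have hu0 : 0 < u := by positivity
  have hdpos : (0 : ℝ) < d := by exact_mod_cast hd1
  have hd1' : (1 : ℝ) ≤ d := by exact_mod_cast hd1
  -- `θ = ε²δ/2`, `w = C (θ/d)^c`, budget `⌈8d/(wδ)⌉`
  set θ : ℝ := ε ^ 2 * δ / 2 with hθ
  have hθpos : 0 < θ := by positivity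
  set w : ℝ := C * (θ / d) ^ c with hw
  have hwpos : 0 < w := by positivity
  have hAA' : ∀ q : MvPolynomial (Fin N) ℝ, q.totalDegree ≤ d →
      (∀ x, 0 ≤ evalBool q x ∧ evalBool q x ≤ 1) → θ < boolVariance q →
        ∃ i, w ≤ influence i q :=
    fun q hq hqb hθq => H N d q θ hd1 hq hqb hθpos hθq.le
  set D : ℕ := Nat.ceil (8 * d / (w * δ)) with hD
  have hDge : 8 * d / (w * δ) ≤ D := Nat.le_ceil _
  have hbudget : 0 < 8 * d / (w * δ) := by positivity
  -- the size of `u = d/(εδ) + 1` relative to `d`, `1/ε`, `1/δ`, `1/θ`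
  have hεδ : 0 < ε * δ := mul_pos hε hδ
  have hεδ1 : ε * δ ≤ 1 := mul_le_one₀ hε1 hδ.le hδ1
  have hprod : ε * δ * u = d + ε * δ := by
    rw [hu]
    field_simp
  have hεu : 1 ≤ ε * u := by
    have h1 : 0 ≤ ε * u * (1 - δ) := mul_nonneg (by positivity) (by linarith)
    nlinarith
  have hδu : 1 ≤ δ * u := by
    have h1 : 0 ≤ δ * u * (1 - ε) := mul_nonneg (by positivity) (by linarith)
    nlinarith
  have hTu : (d : ℝ) ≤ u := by
    have h1 : 0 ≤ u * (1 - ε * δ) := mul_nonneg hu0.le (by linarith)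
    nlinarith
  have hdu : (d : ℝ) ≤ 2 * u := by linarith
  have hθu : 1 ≤ 2 * θ * u ^ 3 := by
    have : 2 * θ * u ^ 3 = (ε * u) ^ 2 * (δ * u) := by
      rw [hθ]
      ring
    rw [this]
    exact one_le_mul_of_one_le_of_one_le (one_le_pow₀ hεu) hδu
  have hK : 8 * (d : ℝ) / (w * δ) ≤ 16 * 2 ^ c * 2 ^ c / C * u ^ (4 * c + 2) := by
    rw [div_le_iff₀ (by positivity)]
    have hC0 : C ≠ 0 := hC.ne'
    have hd0 : (d : ℝ) ≠ 0 := hdpos.ne'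
    have hwδ : 16 * 2 ^ c * 2 ^ c / C * u ^ (4 * c + 2) * (w * δ) =
        16 * 2 ^ c * 2 ^ c * u ^ (4 * c + 2) * θ ^ c * δ / (d : ℝ) ^ c := by
      rw [hw, div_pow]
      field_simp
    rw [hwδ, le_div_iff₀ (by positivity)]
    calc 8 * (d : ℝ) * (d : ℝ) ^ c = 8 * (d : ℝ) ^ (c + 1) := by ring
      _ ≤ _ := queryBudget_arith c hu0.le hdpos.le hdu hθu hδu
  set t := simTree θ w D p with ht
  refine ⟨?_, ?_⟩
  · -- the number of queries
    have hu1 : (1 : ℝ) ≤ u ^ (4 * c + 2) := one_le_pow₀ (by linarith)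
    have hceil : 16 * 2 ^ c * 2 ^ c / C ≤ (Nat.ceil (16 * 2 ^ c * 2 ^ c / C) : ℝ) :=
      Nat.le_ceil _
    calc (t.depth : ℝ) ≤ D := by exact_mod_cast depth_simTree_le θ w D p
      _ ≤ 8 * d / (w * δ) + 1 := (Nat.ceil_lt_add_one hbudget.le).le
      _ ≤ 16 * 2 ^ c * 2 ^ c / C * u ^ (4 * c + 2) + 1 := by linarith
      _ ≤ (Nat.ceil (16 * 2 ^ c * 2 ^ c / C) + 1 : ℕ) * u ^ (4 * c + 2) := by
          have h := mul_le_mul_of_nonneg_right hceil (zero_le_one.trans hu1)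
          push_cast
          linarith
  · -- the error bound: bad inputs either halt early and err, or exhaust the budget
    have hA := sum_cost_simTree_mul_le θ w d hwpos hAA' D p hdeg hbd
    have hB := haltError_simTree_le θ w d ε hwpos hθpos.le hε hAA' D p hdeg hbd
    have hM := t.markov_cost D
    rw [← ht] at hA hB
    have hI : ∑ j, influence j p ≤ 4 * d := sum_influence_le hdeg hbd
    -- pointwise: bad ⇒ (halted early and bad) or (budget exhausted)
    have hpt : ∀ x, (if ε < |t.eval x - evalBool p x| then (1 : ℝ) else 0) ≤
        (if t.cost x < D ∧ ε < |t.eval x - evalBool p x| then (1 : ℝ) else 0) +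
          (if t.cost x = D then (1 : ℝ) else 0) := by
      intro x
      have hc : t.cost x ≤ D := cost_simTree_le θ w D p x
      rcases hc.lt_or_eq with hlt | heq
      · by_cases hb : ε < |t.eval x - evalBool p x| <;> simp [hlt, hlt.ne, hb]
      · by_cases hb : ε < |t.eval x - evalBool p x| <;> simp [heq, hb]
    have hcard : ((Finset.univ.filter fun x : Fin N → Bool =>
        ε < |t.eval x - evalBool p x|).card : ℝ) =
          ∑ x, (if ε < |t.eval x - evalBool p x| then (1 : ℝ) else 0) := by
      rw [Finset.natCast_card_filter]
    rw [hcard]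
    set S1 : ℝ := ∑ x, (if t.cost x < D ∧ ε < |t.eval x - evalBool p x| then (1 : ℝ) else 0)
      with hS1
    set S2 : ℝ := ∑ x, (if t.cost x = D then (1 : ℝ) else 0) with hS2
    have hsum : ∑ x, (if ε < |t.eval x - evalBool p x| then (1 : ℝ) else 0) ≤ S1 + S2 := by
      rw [hS1, hS2, ← Finset.sum_add_distrib]
      exact Finset.sum_le_sum fun x _ => hpt x
    have h1 : S1 ≤ 2 ^ N * (δ / 2) := by
      have hε2 : 0 < ε ^ 2 := by positivity
      have : S1 * ε ^ 2 ≤ 2 ^ N * (δ / 2) * ε ^ 2 := by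
        calc S1 * ε ^ 2 ≤ 2 ^ N * θ := hB
          _ = 2 ^ N * (δ / 2) * ε ^ 2 := by rw [hθ]; ring
      exact le_of_mul_le_mul_right this hε2
    have h2 : S2 ≤ 2 ^ N * (δ / 2) := by
      have hS2D : (D : ℝ) * S2 * w ≤ 2 ^ N * (4 * d) := by
        calc (D : ℝ) * S2 * w ≤ (∑ x, (t.cost x : ℝ)) * w :=
              mul_le_mul_of_nonneg_right hM hwpos.le
          _ ≤ 2 ^ N * ∑ j, influence j p := hA
          _ ≤ 2 ^ N * (4 * d) := by gcongr
      have hDw : 8 * d ≤ (D : ℝ) * (w * δ) := (div_le_iff₀ (by positivity)).mp hDge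
      have hS2nn : 0 ≤ S2 := Finset.sum_nonneg fun x _ => by positivity
      have h3 : 8 * (d : ℝ) * S2 ≤ (D : ℝ) * (w * δ) * S2 := mul_le_mul_of_nonneg_right hDw hS2nn
      have h5 : (D : ℝ) * S2 * w * δ ≤ 2 ^ N * (4 * d) * δ :=
        mul_le_mul_of_nonneg_right hS2D hδ.le
      have h7 : S2 * (8 * d) ≤ 2 ^ N * (δ / 2) * (8 * d) := by linarith
      exact le_of_mul_le_mul_right h7 (by positivity)
    linarith

/-- **Aaronson–Ambainis 2014, Thm. 21, for a bounded polynomial of degree `≤ d`, with explicit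
`poly(d, 1/ε, 1/δ)`**: under `AAConjecture` there are constants `C, k` such that every real
polynomial `p` in `N` variables of total degree `≤ d` (`d ≥ 1`) with `0 ≤ p ≤ 1` on `{0,1}^N` is,
for all `ε, δ ∈ (0, 1]`, `ε`-approximated on all but `≤ δ · 2^N` inputs by a deterministic
decision tree of depth `≤ C (d/(εδ) + 1)^k` (the simulation `simTree`). [cite: AaronsonAmbainis2014, Thm. 21 (proof, pp. 13–14)] -/
theorem exists_simTree_of_AAConjecture (hAA : AAConjecture) :
    ∃ C k : ℕ, ∀ (N d : ℕ), 1 ≤ d → ∀ p : MvPolynomial (Fin N) ℝ, p.totalDegree ≤ d →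
      (∀ x, 0 ≤ evalBool p x ∧ evalBool p x ≤ 1) → ∀ ε δ : ℝ, 0 < ε → ε ≤ 1 → 0 < δ → δ ≤ 1 →
        ∃ t : RealDecisionTree N, (t.depth : ℝ) ≤ C * ((d : ℝ) / (ε * δ) + 1) ^ k ∧
          ((univ.filter fun x : Fin N → Bool => ε < |t.eval x - evalBool p x|).card : ℝ) ≤
            δ * 2 ^ N := by
  obtain ⟨c, C, hC, H⟩ := hAA
  refine ⟨Nat.ceil (16 * 2 ^ c * 2 ^ c / C) + 1, 4 * c + 2, ?_⟩
  intro N d hd1 p hdeg hbd ε δ hε hε1 hδ hδ1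
  exact ⟨_, simTree_depth_error_le hC H hd1 hdeg hbd hε hε1 hδ hδ1⟩

end ClassicalSimulation

end Literature.Computability.QuantumComplexity

end
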